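import Summits.HubbardSuperconductivity.HubbardSuperconductivity.Theses.ParityLeeYang
import Literature.MathematicalPhysics.QuantumLattice.HubbardSpinSplit
import Literature.MathematicalPhysics.QuantumLattice.TraceReflectionPositivityProofs
import Literature.MathematicalPhysics.QuantumLattice.HubbardWave0LiebProofs

/-!
# Route `ParityLeeYang`: support `AttractiveParityNonneg` (stmt-HubbardSuperconductivity-8384)

**The parity-twisted partition function of the attractive Hubbard model is non-negative**:
for every finite graph, hopping `t`, `U ≤ 0`, `μ ∈ ℝ` and `β ≥ 0`,
`Re Tr[(-1)^N e^{-β(H(t,U) - μN)}] ≥ 0`.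

Proof (Kubo–Kishi 1990 / Fröhlich–Israel–Lieb–Simon 1978 §3 ex. 3, as organised in the tree):
under the spin factorisation `Φ : 𝓕(Λ × {↑,↓}) ≅ 𝓕(Λ) ⊗ 𝓕(Λ)` of `HubbardSpinSplit`
(`spinSplitHom`, all up orbitals before all down orbitals), the grand-canonical Hamiltonian is
`Φ(H - μN) = K ⊗ 1 + 1 ⊗ K + U Σ_x n_x ⊗ n_x` with the REAL spinless one-body operator
`K = hoppingMatrix G t - μN` (`spinSplitHom_hamiltonianWith`), and the parity is
`Φ((-1)^N) = P ⊗ P` (`spinSplitHom_parityOp`). With `A = -βK` (`Ā = A`), `F = P` (`F̄ = F`) and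
`C_x = √(-βU) n_x` (`C̄_x ⊗ C_x = -βU n_x ⊗ n_x`, using `U ≤ 0 ≤ β`) this is exactly the shape
`Tr[(F̄ ⊗ F) exp(Ā ⊗ 1 + 1 ⊗ A + Σ_x C̄_x ⊗ C_x)]` of the tree's PROVED reflection-positivity theorem
`FrohlichIsraelLiebSimon1978_thm21_matrix_holds` (FILS I, Thm 2.1 with §3 example 3), which is
therefore a non-negative real; `Φ` preserves traces and commutes with `exp`
(`trace_spinSplitHom`, `spinSplitHom_exp`). No definition is introduced here.

Sources: K. Kubo, T. Kishi, PRB 41 (1990) 4866 (proof of Thm 1); J. Fröhlich, R. Israel,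
E. H. Lieb, B. Simon, CMP 62 (1978) 1, §2 Thm 2.1, §3 ex. 3; E. H. Lieb, PRL 62 (1989) 1201.
-/

set_option linter.dupNamespace false

namespace Summit.HubbardSuperconductivity.HubbardSuperconductivity.Theorems.ParityLeeYang

open Matrix Finset
open scoped Kronecker
open Literature.MathematicalPhysics.QuantumLattice
open Summit.HubbardSuperconductivity.HubbardSuperconductivity.Theses.ParityLeeYang

/-- The spinless one-body operator `K = T - μN` of the Hubbard model is a real matrix in the
occupation basis. [folklore] -/
theorem map_conj_hoppingMatrix_sub {Λ : Type*} [LinearOrder Λ] [Fintype Λ] (G : SimpleGraph Λ)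
    [DecidableRel G.Adj] (t μ : ℝ) :
    (hoppingMatrix G t - (μ : ℂ) • totalNumberOp).map (starRingEnd ℂ) =
      hoppingMatrix G t - (μ : ℂ) • totalNumberOp := by
  ext s u
  rw [map_apply, Matrix.sub_apply, Matrix.smul_apply, map_sub, smul_eq_mul, map_mul,
    Complex.conj_ofReal, totalNumberOp_eq_diagonal, diagonal_apply]
  congr 1
  · exact LiebThm1.star_hoppingMatrix_apply t s u
  · congr 1
    split_ifs <;> simp

/-- The fermion parity is a real (diagonal) matrix. [folklore] -/
theorem map_conj_parityOp {ι : Type*} [LinearOrder ι] :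
    (parityOp : Matrix (Finset ι) (Finset ι) ℂ).map (starRingEnd ℂ) = parityOp := by
  ext s u
  simp only [map_apply, parityOp, diagonal_apply]
  split_ifs <;> simp

/-- A real multiple of a number operator is a real matrix. [folklore] -/
theorem map_conj_smul_numberAt {ι : Type*} [LinearOrder ι] [Fintype ι] (r : ℝ) (x : ι) :
    ((r : ℂ) • numberAt x : Matrix (Finset ι) (Finset ι) ℂ).map (starRingEnd ℂ) = (r : ℂ) • numberAt x := by
  ext s u
  rw [numberAt_eq_diagonal, map_apply, Matrix.smul_apply, diagonal_apply, smul_eq_mul, map_mul,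
    Complex.conj_ofReal]
  congr 1
  split_ifs <;> simp

/-- **`AttractiveParityNonneg` holds** (route `ParityLeeYang`, support item
`stmt-HubbardSuperconductivity-8384`): `0 ≤ Re Tr[(-1)^N e^{-β(H(t,U)-μN)}]` for `U ≤ 0 ≤ β`, by
the spin factorisation and Fröhlich–Israel–Lieb–Simon trace reflection positivity.
[cite: KuboKishi1990, proof of Thm 1] [cite: FrohlichIsraelLiebSimon1978, §2 Thm 2.1 and §3 example 3] -/
theorem attractiveParityNonneg_proof : AttractiveParityNonneg := by
  intro Λ _ _ G _ t U μ β hU hβ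
  -- the reflection-positivity datum
  have hpos : 0 ≤ -(β * U) := neg_nonneg.2 (mul_nonpos_of_nonneg_of_nonpos hβ hU)
  have hFILS := FrohlichIsraelLiebSimon1978_thm21_matrix_holds (Finset Λ) Λ
    ((-(β : ℂ)) • (hoppingMatrix G t - (μ : ℂ) • totalNumberOp)) parityOp
    (fun x => ((Real.sqrt (-(β * U)) : ℝ) : ℂ) • numberAt x)
  dsimp only at hFILS
  -- reality of the pieces
  have hAreal : ((-(β : ℂ)) • (hoppingMatrix G t - (μ : ℂ) • totalNumberOp)).map (starRingEnd ℂ) =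
      (-(β : ℂ)) • (hoppingMatrix G t - (μ : ℂ) • totalNumberOp) := by
    conv_rhs => rw [← map_conj_hoppingMatrix_sub G t μ]
    ext s u
    rw [map_apply, Matrix.smul_apply, Matrix.smul_apply, map_apply, smul_eq_mul, smul_eq_mul, map_mul,
      map_neg, Complex.conj_ofReal]
  have hrr : ((Real.sqrt (-(β * U)) : ℝ) : ℂ) * ((Real.sqrt (-(β * U)) : ℝ) : ℂ) =
      (-(β : ℂ)) * (U : ℂ) := by
    rw [← Complex.ofReal_mul, Real.mul_self_sqrt hpos]
    push_cast
    ring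
  have hCC : ∑ x : Λ, (((Real.sqrt (-(β * U)) : ℝ) : ℂ) • numberAt x :
      Matrix (Finset Λ) (Finset Λ) ℂ).map (starRingEnd ℂ) ⊗ₖ
        (((Real.sqrt (-(β * U)) : ℝ) : ℂ) • numberAt x : Matrix (Finset Λ) (Finset Λ) ℂ) =
      ((-(β : ℂ)) * (U : ℂ)) • ∑ x : Λ, numberAt x ⊗ₖ numberAt x := by
    rw [Finset.smul_sum]
    refine Finset.sum_congr rfl fun x _ => ?_
    rw [map_conj_smul_numberAt, smul_kronecker, kronecker_smul, smul_smul, hrr]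
  -- the exponent and the twist are the images of `-β(H - μN)` and of the parity under `Φ`
  have hexp : ((-(β : ℂ)) • (hoppingMatrix G t - (μ : ℂ) • totalNumberOp)).map (starRingEnd ℂ) ⊗ₖ
        (1 : Matrix (Finset Λ) (Finset Λ) ℂ) +
      (1 : Matrix (Finset Λ) (Finset Λ) ℂ) ⊗ₖ ((-(β : ℂ)) • (hoppingMatrix G t - (μ : ℂ) • totalNumberOp)) +
      ∑ x : Λ, (((Real.sqrt (-(β * U)) : ℝ) : ℂ) • numberAt x :
        Matrix (Finset Λ) (Finset Λ) ℂ).map (starRingEnd ℂ) ⊗ₖ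
          (((Real.sqrt (-(β * U)) : ℝ) : ℂ) • numberAt x : Matrix (Finset Λ) (Finset Λ) ℂ) =
      spinSplitHom (-(β : ℂ) • hamiltonianWith G t U μ) := by
    rw [hAreal, hCC, smul_kronecker, kronecker_smul, map_smul, spinSplitHom_hamiltonianWith,
      smul_add, smul_add, smul_smul]
  have hFF : (parityOp : Matrix (Finset Λ) (Finset Λ) ℂ).map (starRingEnd ℂ) ⊗ₖ
      (parityOp : Matrix (Finset Λ) (Finset Λ) ℂ) =
      spinSplitHom (parityOp : Matrix (Finset (Orb Λ)) (Finset (Orb Λ)) ℂ) := by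
    rw [map_conj_parityOp, spinSplitHom_parityOp]
  -- transport the trace back to the Hubbard Fock space
  rw [hexp, hFF, ← spinSplitHom_exp, ← map_mul, trace_spinSplitHom] at hFILS
  exact hFILS.1

end Summit.HubbardSuperconductivity.HubbardSuperconductivity.Theorems.ParityLeeYang
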